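import Literature.NumberTheory.GaloisRepresentations.ResiduallyReducibleOfStableLine
import Literature.FieldTheory.AlgClosed.PadicAlgClEquivComplex
import Literature.NumberTheory.EllipticCurves.NewformGaloisRep
import HarnessLib

/-!
# Transport of finite-image Galois representations along (discontinuous) coefficient maps

Topic `Literature/NumberTheory/GaloisRepresentations`; namespace
`Literature.NumberTheory.GaloisRepresentations`.  A theorems-only file (no definition of a
notion, no named fact; D-0026).

An Artin representation is usually regarded indifferently as `ρ : Γ_K → GL_n(ℂ)` or as
`ρ : Γ_K → GL_n(ℚ̄_p)` "via a fixed isomorphism `ι : ℚ̄_p ≅ ℂ`" (Deligne–Serre 1974, §8.6–8.7;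
Allen 2014, §5.1.1: "`ρ₁ = Ind χ ξ` … a cuspidal Hilbert modular newform `f₁` of weight one such
that `ρ_{f₁} ≅ ρ₁`", where `ρ₁` is `2`-adic and `ρ_{f₁}` is complex).  The isomorphism `ι` is
not continuous, so the identification uses that `ρ` has FINITE image, i.e. open kernel: a group
homomorphism out of `Γ_K` with open kernel is continuous for ANY topology on the target.  This
file proves that bookkeeping in the tree's framed vocabulary (`FramedGaloisRep K A n`,
continuous `Γ_K →ₜ* GL_n(A)`):

* `FramedGaloisRep.exists_map_of_isOpen_ker` — a framed representation with open kernel can be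
  pushed along every ring homomorphism `φ : A →+* B` (continuous or not): there is
  `ρ' : Γ_K →ₜ* GL_n(B)` with `ρ' σ = GL_n(φ)(ρ σ)`, again with open kernel;
* along such a pair `ρ' = GL_n(φ) ∘ ρ` the tree's predicates transport:
  `IsUnramifiedAt` (`isUnramifiedAt_of_map`, and back for injective `φ`), `HasFrobCharpolyAt`
  (`hasFrobCharpolyAt_map`, `Matrix.charpoly_map`), `IsOdd` (`isOdd_of_map`), solvability of the
  image (`isSolvable_range_of_map`), common eigenvectors for a ring ISOMORPHISM of fields
  (`hasCommonEigenvector_map_ringEquiv_iff`, hence irreducibility in rank two,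
  `isIrreducible_iff_not_hasCommonEigenvector`), and "attached to the newform `f` away from `S`"
  (`IsGaloisRepOfNewform1.of_map`: the coefficient map becomes `φ ∘ ι`);
* `isSolvable_range_of_index_two` — the image of a homomorphism which is commutative on a
  subgroup of index two is solvable (metabelian); this is how the solvability of the image of a
  representation INDUCED from a quadratic extension (`Ind_{G_L}^{G_K} ψ`, monomial: diagonal on
  `G_L`) is read off, `isSolvable_range_of_monomial`;
* `not_hasCommonEigenvector_of_isReductionOf` — a `p`-adic representation one of whose
  reductions has no common eigenvector has none (an invariant line gives a stable lattice line,
  `IsReductionOf.hasCommonEigenvector_comp`);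
* the abstract field isomorphism `ℚ̄_p ≃+* ℂ` exists (the tree's
  `PadicAlgCl.nonempty_ringEquiv_complex`, `FieldTheory/AlgClosed/PadicAlgClEquivComplex`: both
  are algebraically closed of characteristic `0` and cardinality `𝔠`), whence the round trip
  `FramedGaloisRep.exists_complex_model_of_isOpen_ker`: a `p`-adic framed representation with
  open kernel has a complex model `ρℂ = GL_n(ψ) ∘ ρ`, `ψ : ℚ̄_p ≃+* ℂ`, with
  `ρ = GL_n(ψ⁻¹) ∘ ρℂ`.

## References

* P. Deligne, J.-P. Serre, *Formes modulaires de poids 1*, Ann. Sci. ÉNS (4) 7 (1974), §8.6–8.7.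
* P. B. Allen, Compositio Math. 150 (2014) = arXiv:1301.1113v2, §5.1.1 (Lemma 87).
* J.-P. Serre, *Abelian ℓ-adic representations* (1968), Ch. I §1.1, Remark (finite image ⇔
  open kernel).
-/

noncomputable section

open scoped MatrixGroups NumberField
open Field IsDedekindDomain Polynomial

namespace Literature.NumberTheory.GaloisRepresentations

universe u v w

/-! ### Continuity from an open kernel -/

section OpenKer

/-- A group homomorphism out of a topological group with open kernel is continuous, whatever the
topology of the target group (private copy of `MonoidHom.continuous_of_isOpen_ker` of
`Automorphic/LanglandsTetrahedral`, not imported here for layering). [folklore] -/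
private theorem continuous_of_isOpen_ker_aux₄ {G H : Type*} [Group G] [TopologicalSpace G]
    [IsTopologicalGroup G] [Group H] [TopologicalSpace H] [ContinuousMul H] (f : G →* H)
    (hf : IsOpen (f.ker : Set G)) : Continuous f := by
  apply continuous_of_continuousAt_one f
  rw [ContinuousAt, map_one]
  intro U hU
  rw [Filter.mem_map]
  apply Filter.mem_of_superset (hf.mem_nhds (by simp))
  intro g hg
  rw [SetLike.mem_coe, MonoidHom.mem_ker] at hg
  rw [Set.mem_preimage, hg]
  exact mem_of_mem_nhds hU

variable {K : Type u} [Field K] {A : Type v} [CommRing A] [TopologicalSpace A]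
  {B : Type w} [CommRing B] [TopologicalSpace B] [IsTopologicalRing B] {n : ℕ}

/-- **Pushing a finite-image framed representation along an arbitrary ring homomorphism.**  If
`ρ : Γ_K →ₜ* GL_n(A)` has open kernel (equivalently finite image, `Γ_K` being compact) then for
every ring homomorphism `φ : A →+* B` — no continuity assumed, e.g. an abstract field isomorphism
`ℚ̄_p ≅ ℂ` — the homomorphism `σ ↦ GL_n(φ)(ρ σ)` is again continuous, with open kernel.
(Deligne–Serre 1974, §8.7: complex and `ℓ`-adic avatars of a weight-one form's representation.)
[folklore] -/
theorem FramedGaloisRep.exists_map_of_isOpen_ker (ρ : FramedGaloisRep K A n)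
    (hρ : IsOpen ((ρ : absoluteGaloisGroup K →* GL (Fin n) A).ker : Set (absoluteGaloisGroup K)))
    (φ : A →+* B) :
    ∃ ρ' : FramedGaloisRep K B n,
      (∀ σ, ρ' σ = Matrix.GeneralLinearGroup.map φ (ρ σ)) ∧
      (ρ : absoluteGaloisGroup K →* GL (Fin n) A).ker ≤
        (ρ' : absoluteGaloisGroup K →* GL (Fin n) B).ker ∧
      IsOpen ((ρ' : absoluteGaloisGroup K →* GL (Fin n) B).ker : Set (absoluteGaloisGroup K)) := by
  let f : absoluteGaloisGroup K →* GL (Fin n) B :=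
    (Matrix.GeneralLinearGroup.map φ).comp (ρ : absoluteGaloisGroup K →* GL (Fin n) A)
  have hle : (ρ : absoluteGaloisGroup K →* GL (Fin n) A).ker ≤ f.ker := fun σ hσ => by
    rw [MonoidHom.mem_ker] at hσ ⊢
    simp only [f, MonoidHom.comp_apply, hσ, map_one]
  have hopen : IsOpen (f.ker : Set (absoluteGaloisGroup K)) := Subgroup.isOpen_mono hle hρ
  exact ⟨⟨f, continuous_of_isOpen_ker_aux₄ f hopen⟩, fun σ => rfl, hle, hopen⟩

end OpenKer

/-! ### Transport of the standard predicates along `ρ' = GL_n(φ) ∘ ρ` -/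

section Transport

variable {K : Type u} [Field K] {A : Type v} [CommRing A] [TopologicalSpace A]
  {B : Type w} [CommRing B] [TopologicalSpace B] {n : ℕ}
  {ρ : FramedGaloisRep K A n} {ρ' : FramedGaloisRep K B n} {φ : A →+* B}

/-- Unramifiedness is preserved by pushing along a coefficient map. [folklore] -/
theorem FramedGaloisRep.isUnramifiedAt_of_map (hρ' : ∀ σ, ρ' σ = Matrix.GeneralLinearGroup.map φ (ρ σ))
    {v : HeightOneSpectrum (𝓞 K)} (h : ρ.IsUnramifiedAt v) : ρ'.IsUnramifiedAt v :=
  fun 𝔓 h𝔓 σ hσ => by rw [hρ' σ, h 𝔓 h𝔓 σ hσ, map_one]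

/-- Unramifiedness is reflected by pushing along an INJECTIVE coefficient map. [folklore] -/
theorem FramedGaloisRep.isUnramifiedAt_of_map_of_injective
    (hρ' : ∀ σ, ρ' σ = Matrix.GeneralLinearGroup.map φ (ρ σ)) (hφ : Function.Injective φ)
    {v : HeightOneSpectrum (𝓞 K)} (h : ρ'.IsUnramifiedAt v) : ρ.IsUnramifiedAt v := by
  intro 𝔓 h𝔓 σ hσ
  have e := h 𝔓 h𝔓 σ hσ
  rw [hρ' σ] at e
  refine Units.ext (Matrix.ext fun i j => hφ ?_)
  have eij := congrArg (fun M : GL (Fin n) B => (M : Matrix (Fin n) (Fin n) B) i j) e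
  simp only [Matrix.GeneralLinearGroup.map_apply, Units.val_one] at eij
  rw [eij, Units.val_one]
  by_cases hij : i = j
  · subst hij; simp
  · simp [Matrix.one_apply_ne hij]

/-- Frobenius characteristic polynomials are pushed along a coefficient map
(`Matrix.charpoly_map`). [folklore] -/
theorem FramedGaloisRep.hasFrobCharpolyAt_map (hρ' : ∀ σ, ρ' σ = Matrix.GeneralLinearGroup.map φ (ρ σ))
    {v : HeightOneSpectrum (𝓞 K)} {P : Polynomial A} (h : ρ.HasFrobCharpolyAt v P) :
    ρ'.HasFrobCharpolyAt v (P.map φ) := by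
  intro 𝔓 h𝔓 σ hσ
  have e := h 𝔓 h𝔓 σ hσ
  unfold FramedRep.charpoly at e ⊢
  have hmat : ((ρ' σ : GL (Fin n) B) : Matrix (Fin n) (Fin n) B) =
      ((ρ σ : GL (Fin n) A) : Matrix (Fin n) (Fin n) A).map φ := by
    ext i j
    rw [hρ' σ, Matrix.GeneralLinearGroup.map_apply, Matrix.map_apply]
  rw [hmat, Matrix.charpoly_map, e]

/-- Oddness is preserved by pushing along a coefficient map (`det` commutes with `GL_n(φ)` and
`φ(-1) = -1`). [folklore] -/
theorem FramedGaloisRep.isOdd_of_map (hρ' : ∀ σ, ρ' σ = Matrix.GeneralLinearGroup.map φ (ρ σ))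
    (h : ρ.IsOdd) : ρ'.IsOdd := by
  intro ψ c hc
  rw [hρ' c, Matrix.GeneralLinearGroup.map_det, h ψ c hc]
  ext
  simp

/-- The image of the pushed representation is a quotient of the image, hence solvable when the
image is. [folklore] -/
theorem FramedGaloisRep.isSolvable_range_of_map
    (hρ' : ∀ σ, ρ' σ = Matrix.GeneralLinearGroup.map φ (ρ σ))
    (h : IsSolvable (ρ : absoluteGaloisGroup K →* GL (Fin n) A).range) :
    IsSolvable (ρ' : absoluteGaloisGroup K →* GL (Fin n) B).range := by
  -- `range ρ' = (range ρ).map GL_n(φ)`, the surjective image of `range ρ`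
  let g : (ρ : absoluteGaloisGroup K →* GL (Fin n) A).range →*
      (ρ' : absoluteGaloisGroup K →* GL (Fin n) B).range :=
    ((Matrix.GeneralLinearGroup.map φ).comp
      (ρ : absoluteGaloisGroup K →* GL (Fin n) A).range.subtype).codRestrict _ (by
        rintro ⟨_, σ, rfl⟩
        exact ⟨σ, by rw [MonoidHom.comp_apply, Subgroup.coe_subtype, MonoidHom.coe_coe, hρ' σ]; rfl⟩)
  have hg : Function.Surjective g := by
    rintro ⟨_, σ, rfl⟩
    refine ⟨⟨ρ σ, σ, rfl⟩, Subtype.ext ?_⟩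
    simp only [g, MonoidHom.codRestrict_apply, MonoidHom.comp_apply, Subgroup.coe_subtype,
      MonoidHom.coe_coe, hρ' σ]
  exact solvable_of_surjective hg

end Transport

/-! ### Common eigenvectors along a ring isomorphism of fields -/

section Eigen

variable {G : Type*} [Group G] {k : Type v} [Field k] {k' : Type w} [Field k']

/-- A common eigenvector is pushed along any field homomorphism. [folklore] -/
theorem hasCommonEigenvector_map (φ : k →+* k') {ρ : G →* GL (Fin 2) k}
    (h : HasCommonEigenvector ρ) :
    HasCommonEigenvector ((Matrix.GeneralLinearGroup.map φ).comp ρ) := by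
  obtain ⟨v, hv0, key⟩ := h
  refine ⟨fun i => φ (v i), ?_, fun g => ?_⟩
  · intro h0
    apply hv0
    funext i
    have hi := congrFun h0 i
    simp only [Pi.zero_apply, map_eq_zero] at hi
    exact hi
  · obtain ⟨a, ha⟩ := key g
    refine ⟨φ a, ?_⟩
    funext i
    have hi := congrFun ha i
    simp only [Matrix.mulVec, dotProduct, Fin.sum_univ_two, Pi.smul_apply, smul_eq_mul] at hi ⊢
    rw [MonoidHom.comp_apply]
    simp only [Matrix.GeneralLinearGroup.map_apply]
    rw [← map_mul, ← map_mul, ← map_add, hi, map_mul]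

/-- Along a ring ISOMORPHISM of fields, having a common eigenvector is invariant. [folklore] -/
theorem hasCommonEigenvector_map_ringEquiv_iff (φ : k ≃+* k') (ρ : G →* GL (Fin 2) k) :
    HasCommonEigenvector ((Matrix.GeneralLinearGroup.map (φ : k →+* k')).comp ρ) ↔
      HasCommonEigenvector ρ := by
  refine ⟨fun h => ?_, hasCommonEigenvector_map (φ : k →+* k')⟩
  have h' := hasCommonEigenvector_map (φ.symm : k' →+* k) h
  have e : (Matrix.GeneralLinearGroup.map (φ.symm : k' →+* k)).comp
      ((Matrix.GeneralLinearGroup.map (φ : k →+* k')).comp ρ) = ρ := by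
    refine MonoidHom.ext fun g => Units.ext (Matrix.ext fun i j => ?_)
    simp [Matrix.GeneralLinearGroup.map_apply]
  rwa [e] at h'

end Eigen

/-! ### Solvable image from an abelian subgroup of index two (induced representations) -/

section IndexTwo

variable {G H : Type*} [Group G] [Group H]

/-- **Metabelian images.**  If `f : G →* H` is commutative on a subgroup `K ≤ G` of index two,
then `f(G)` is solvable: `G' ≤ K` (the quotient `G/K` has order two), so `f(G)'' ≤ f(K') = 1`.
This is the solvability of the image of a representation induced from a character of a quadratic
extension. [folklore] -/
theorem isSolvable_range_of_index_two (f : G →* H) (K : Subgroup G) (hK : K.index = 2)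
    (hcomm : ∀ x ∈ K, ∀ y ∈ K, f x * f y = f y * f x) : IsSolvable f.range := by
  rw [isSolvable_def]
  refine ⟨2, ?_⟩
  have hsurj : Function.Surjective f.rangeRestrict := f.rangeRestrict_surjective
  have h1 : derivedSeries G 1 ≤ K := by
    rw [derivedSeries_one, commutator_def, Subgroup.commutator_le]
    intro a _ b _
    rw [commutatorElement_def, Subgroup.mul_mem_iff_of_index_two hK,
      Subgroup.mul_mem_iff_of_index_two hK, Subgroup.mul_mem_iff_of_index_two hK, inv_mem_iff,
      inv_mem_iff]
    tauto
  have h2 : derivedSeries G 2 ≤ ⁅K, K⁆ := by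
    rw [derivedSeries_succ]
    exact Subgroup.commutator_mono h1 h1
  have h3 : (⁅K, K⁆ : Subgroup G).map f.rangeRestrict = ⊥ := by
    rw [Subgroup.map_commutator, Subgroup.commutator_eq_bot_iff_le_centralizer]
    rintro _ ⟨x, hx, rfl⟩
    rw [Subgroup.mem_centralizer_iff]
    rintro _ ⟨y, hy, rfl⟩
    refine Subtype.ext ?_
    simp only [Subgroup.coe_mul, MonoidHom.coe_rangeRestrict]
    exact hcomm y hy x hx
  refine le_bot_iff.mp ?_
  calc derivedSeries f.range 2 ≤ (derivedSeries G 2).map f.rangeRestrict :=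
        derivedSeries_le_map_derivedSeries hsurj 2
    _ ≤ (⁅K, K⁆ : Subgroup G).map f.rangeRestrict := Subgroup.map_mono h2
    _ = ⊥ := h3

/-- **The image of a monomial representation is solvable**: if `ρ : G →* GL₂(R)` is diagonal on
a subgroup `K` of index two (i.e. `ρ ≅ Ind_K^G ψ`), its image is solvable — diagonal matrices
commute. [folklore] -/
theorem isSolvable_range_of_monomial {R : Type*} [CommRing R] (ρ : G →* GL (Fin 2) R)
    (K : Subgroup G) (hK : K.index = 2)
    (hdg : ∀ h ∈ K, (ρ h).val 0 1 = 0 ∧ (ρ h).val 1 0 = 0) : IsSolvable ρ.range := by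
  refine isSolvable_range_of_index_two ρ K hK fun x hx y hy => ?_
  obtain ⟨hx01, hx10⟩ := hdg x hx
  obtain ⟨hy01, hy10⟩ := hdg y hy
  refine Units.ext (Matrix.ext fun i j => ?_)
  simp only [Units.val_mul, Matrix.mul_apply, Fin.sum_univ_two]
  fin_cases i <;> fin_cases j <;>
    simp only [Fin.zero_eta, Fin.isValue, Fin.mk_one, hx01, hx10, hy01, hy10, mul_zero, zero_mul,
      add_zero, zero_add, mul_comm]

/-- The same for the representation pushed along a coefficient map (e.g. an integral model
`ρ₀ : G →* GL₂(O)` monomial with respect to `K`, and `ρ = GL₂(O ⊆ F) ∘ ρ₀`). [folklore] -/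
theorem isSolvable_range_of_monomial_map {R S : Type*} [CommRing R] [CommRing S] (φ : R →+* S)
    (ρ₀ : G →* GL (Fin 2) R) (ρ : G →* GL (Fin 2) S)
    (hρ : ∀ g, Matrix.GeneralLinearGroup.map φ (ρ₀ g) = ρ g) (K : Subgroup G) (hK : K.index = 2)
    (hdg : ∀ h ∈ K, (ρ₀ h).val 0 1 = 0 ∧ (ρ₀ h).val 1 0 = 0) : IsSolvable ρ.range := by
  refine isSolvable_range_of_monomial ρ K hK fun h hh => ?_
  obtain ⟨h01, h10⟩ := hdg h hh
  have e01 : (Matrix.GeneralLinearGroup.map φ (ρ₀ h)).val 0 1 = φ ((ρ₀ h).val 0 1) :=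
    Matrix.GeneralLinearGroup.map_apply φ 0 1 (ρ₀ h)
  have e10 : (Matrix.GeneralLinearGroup.map φ (ρ₀ h)).val 1 0 = φ ((ρ₀ h).val 1 0) :=
    Matrix.GeneralLinearGroup.map_apply φ 1 0 (ρ₀ h)
  rw [← hρ h, e01, e10, h01, h10, map_zero]
  exact ⟨rfl, rfl⟩

end IndexTwo

/-! ### Irreducibility from an irreducible reduction -/

section Reduction

variable {K : Type u} [Field K] {ℓ : ℕ} [Fact ℓ.Prime] {k : Type w} [Field k]

/-- **A `p`-adic representation with a reduction without common eigenvector has no common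
eigenvector** (contrapositive of "an invariant line over `ℚ̄_p` gives a stable line in every
lattice, hence in every reduction", `IsReductionOf.hasCommonEigenvector_comp`). In particular such
a `ρ` is irreducible (`isIrreducible_iff_not_hasCommonEigenvector`). [folklore] -/
theorem FramedGaloisRep.not_hasCommonEigenvector_of_isReductionOf
    (ρ : FramedGaloisRep K (PadicAlgCl ℓ) 2) {ι : padicAlgClResidueField ℓ →+* k}
    {τ : absoluteGaloisGroup K →* GL (Fin 2) k} (hτ : ρ.IsReductionOf ι τ)
    (hce : ¬ HasCommonEigenvector τ) :
    ¬ HasCommonEigenvector (ρ : absoluteGaloisGroup K →* GL (Fin 2) (PadicAlgCl ℓ)) := by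
  intro h
  apply hce
  have h' := IsReductionOf.hasCommonEigenvector_comp hτ (MonoidHom.id _)
    (by rwa [MonoidHom.comp_id])
  rwa [MonoidHom.comp_id] at h'

/-- Hence such a `ρ` is irreducible as a representation on `ℚ̄_p²`. [folklore] -/
theorem FramedGaloisRep.isIrreducible_of_isReductionOf
    (ρ : FramedGaloisRep K (PadicAlgCl ℓ) 2) {ι : padicAlgClResidueField ℓ →+* k}
    {τ : absoluteGaloisGroup K →* GL (Fin 2) k} (hτ : ρ.IsReductionOf ι τ)
    (hce : ¬ HasCommonEigenvector τ) : ρ.toGaloisRep.IsIrreducible :=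
  (isIrreducible_iff_not_hasCommonEigenvector
    (ρ : absoluteGaloisGroup K →* GL (Fin 2) (PadicAlgCl ℓ))).2
    (ρ.not_hasCommonEigenvector_of_isReductionOf hτ hce)

end Reduction

/-! ### The abstract isomorphism `ℚ̄_p ≅ ℂ` and complex models -/

section Complex

variable {K : Type u} [Field K] {p : ℕ} [Fact p.Prime] {n : ℕ}

/-- **Complex model of a finite-image `p`-adic representation.**  A framed
`ρ : Γ_K →ₜ* GL_n(ℚ̄_p)` with open kernel is `GL_n(ψ⁻¹) ∘ ρℂ` for a continuous
`ρℂ : Γ_K →ₜ* GL_n(ℂ)` (an Artin representation, `FramedArtinRep K n`) and a field isomorphism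
`ψ : ℚ̄_p ≃+* ℂ`, namely `ρℂ = GL_n(ψ) ∘ ρ`; `ρℂ` has the same kernel.  (Deligne–Serre 1974,
§8.7; Allen 2014, §5.1.1, "`ρ_{f₁} ≅ ρ₁`".) [folklore] -/
theorem FramedGaloisRep.exists_complex_model_of_isOpen_ker (ρ : FramedGaloisRep K (PadicAlgCl p) n)
    (hρ : IsOpen ((ρ : absoluteGaloisGroup K →* GL (Fin n) (PadicAlgCl p)).ker :
      Set (absoluteGaloisGroup K))) :
    ∃ (ψ : PadicAlgCl p ≃+* ℂ) (ρℂ : FramedGaloisRep K ℂ n),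
      (∀ σ, ρℂ σ = Matrix.GeneralLinearGroup.map (ψ : PadicAlgCl p →+* ℂ) (ρ σ)) ∧
      (∀ σ, ρ σ = Matrix.GeneralLinearGroup.map (ψ.symm : ℂ →+* PadicAlgCl p) (ρℂ σ)) ∧
      (ρℂ : absoluteGaloisGroup K →* GL (Fin n) ℂ).ker =
        (ρ : absoluteGaloisGroup K →* GL (Fin n) (PadicAlgCl p)).ker ∧
      IsOpen ((ρℂ : absoluteGaloisGroup K →* GL (Fin n) ℂ).ker : Set (absoluteGaloisGroup K)) := by
  obtain ⟨ψ⟩ := PadicAlgCl.nonempty_ringEquiv_complex p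
  obtain ⟨ρℂ, hρℂ, hle, hopen⟩ := ρ.exists_map_of_isOpen_ker hρ (ψ : PadicAlgCl p →+* ℂ)
  have hback : ∀ σ, ρ σ = Matrix.GeneralLinearGroup.map (ψ.symm : ℂ →+* PadicAlgCl p) (ρℂ σ) := by
    intro σ
    rw [hρℂ σ, ← Matrix.GeneralLinearGroup.map_comp_apply]
    refine Units.ext (Matrix.ext fun i j => ?_)
    simp [Matrix.GeneralLinearGroup.map_apply]
  refine ⟨ψ, ρℂ, hρℂ, hback, le_antisymm (fun σ hσ => ?_) hle, hopen⟩
  rw [MonoidHom.mem_ker] at hσ ⊢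
  have hσ' : ρℂ σ = 1 := hσ
  rw [MonoidHom.coe_coe, hback σ, hσ', map_one]

end Complex

/-! ### "Attached to the newform `f`" along a coefficient map -/

section Newform

open scoped ModularForm
open CongruenceSubgroup Literature.NumberTheory.EllipticCurves.ModularForms

variable {A : Type v} [CommRing A] [TopologicalSpace A] {B : Type w} [CommRing B]
  [TopologicalSpace B] {N : ℕ} [NeZero N] {k : ℤ} {f : CuspForm (Gamma1 N) k}

/-- **`ρ ↔ f` away from `S` via `ι` implies `GL₂(φ) ∘ ρ ↔ f` away from `S` via `φ ∘ ι`** —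
unramifiedness and the Frobenius characteristic polynomials `ι(X² - a_q X + ε(q) q^{k-1})` are
pushed along `φ` (`Polynomial.map_map`).  With `φ` an abstract isomorphism `ℂ ≅ ℚ̄_p` (or its
inverse) and `ρ` of finite image this is the passage between the complex and the `p`-adic
representation of a weight-one newform (Deligne–Serre 1974, §8.7). [folklore] -/
theorem _root_.Literature.NumberTheory.EllipticCurves.ModularForms.IsGaloisRepOfNewform1.of_map
    {ι : coeffCharField f →+* A} {S : Set ℕ} {ρ : FramedGaloisRep ℚ A 2}
    (h : IsGaloisRepOfNewform1 f ι S ρ) (φ : A →+* B) {ρ' : FramedGaloisRep ℚ B 2}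
    (hρ' : ∀ σ, ρ' σ = Matrix.GeneralLinearGroup.map φ (ρ σ)) :
    IsGaloisRepOfNewform1 f (φ.comp ι) S ρ' := by
  intro v hv
  obtain ⟨hur, hchar⟩ := h v hv
  refine ⟨FramedGaloisRep.isUnramifiedAt_of_map hρ' hur, ?_⟩
  rw [← Polynomial.map_map]
  exact FramedGaloisRep.hasFrobCharpolyAt_map hρ' hchar

end Newform

end Literature.NumberTheory.GaloisRepresentations

end
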